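import Summits.NavierStokesRegularity.NavierStokesRegularity.Theses.FilamentSkeletonRss

/-!
# Route `FilamentSkeletonRss` · crux `CoreGluing` (stmt-NavierStokesRegularity-15401) — the vacuous branch

Line `zero-accretion-selection`, lead c4 (2026-08-17).  `CoreGluing := SkeletonEquilibrium → RssProfileExists`
is a material implication between two closed propositions, so its truth value is
`¬ SkeletonEquilibrium ∨ RssProfileExists` (`coreGluing_iff_not_skeletonEquilibrium_or_rssProfileExists`).
The leads c1–c3/a1 worked the second disjunct (given the skeleton, the crux IS the open target:
`coreGluing_iff_rssProfileExists_of_skeletonEquilibrium`, p134409).  Since 2026-08-17T02:12Z the sibling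
crux `SkeletonEquilibrium` (stmt-NavierStokesRegularity-15400) carries a registered NEGATION line
(`Cruxes/SkeletonEquilibrium/Lines/kelvin_sonic_negation.lean`: exact `C²` relative equilibria of the
regularised Biot–Savart law with supercritical stagnation points are very probably impossible — the
Kelvin-sonic obstruction, `Lines/Sketch-dead.md` there), which makes the FIRST disjunct the likely way this
crux closes: `coreGluing_of_not_skeletonEquilibrium` is the one-line closing recipe once
`¬ SkeletonEquilibrium` is a tree theorem.  (The route then dies by its own kill criterion (i); the crux
item nevertheless closes `proved`.)  Registered tools stub: `stub_vacuousRouteTools`.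
-/

set_option linter.dupNamespace false

namespace Summit.NavierStokesRegularity.NavierStokesRegularity.Theorems

open Summit.NavierStokesRegularity.NavierStokesRegularity.Theses.FilamentSkeletonRss

/-- **Vacuous closure.**  If the skeleton hypothesis is refuted (the sibling crux's negation line),
`CoreGluing` holds with its hypothesis never consumed. [folklore] -/
theorem coreGluing_of_not_skeletonEquilibrium (h : ¬ SkeletonEquilibrium) : CoreGluing :=
  fun hK1 => absurd hK1 h

/-- **Dichotomy.**  The crux is exactly `¬ SkeletonEquilibrium ∨ RssProfileExists`: either the 2001
skeleton theorem fails as typed (Kelvin-sonic obstruction, stmt-15400 negation line) or Perelman's RSS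
conjecture fails in the filament window (the route target). [folklore] -/
theorem coreGluing_iff_not_skeletonEquilibrium_or_rssProfileExists :
    CoreGluing ↔ (¬ SkeletonEquilibrium ∨ RssProfileExists) := by
  unfold CoreGluing
  exact imp_iff_not_or

/-- **Monotonicity in the hypothesis.**  Any re-cut `S'` of the skeleton statement that IMPLIES the
current one (e.g. a quantitative / ball-exact skeleton family exporting more structure) can only make
the corresponding gluing implication harder: `(S' → SkeletonEquilibrium) → CoreGluing → (S' → Rss)`;
conversely a WEAKER re-cut `S''` (implied by `SkeletonEquilibrium`) with `S'' → Rss` proved closes the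
crux as typed. [folklore] -/
theorem coreGluing_transfer {S' S'' : Prop} :
    ((S' → SkeletonEquilibrium) → CoreGluing → (S' → RssProfileExists)) ∧
    ((SkeletonEquilibrium → S'') → (S'' → RssProfileExists) → CoreGluing) :=
  ⟨fun h hK2 hS' => hK2 (h hS'), fun h h'' hK1 => h'' (h hK1)⟩

/-- Registered tools stub of crux stmt-NavierStokesRegularity-15401 (`ledger workitem stub-add … --name
stub_vacuousRouteTools`): the conjunction of the three bookkeeping facts of this file. [folklore] -/
theorem stub_vacuousRouteTools :
    (¬ Summit.NavierStokesRegularity.NavierStokesRegularity.Theses.FilamentSkeletonRss.SkeletonEquilibrium →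
      Summit.NavierStokesRegularity.NavierStokesRegularity.Theses.FilamentSkeletonRss.CoreGluing) ∧
    (Summit.NavierStokesRegularity.NavierStokesRegularity.Theses.FilamentSkeletonRss.CoreGluing ↔
      (¬ Summit.NavierStokesRegularity.NavierStokesRegularity.Theses.FilamentSkeletonRss.SkeletonEquilibrium ∨
        Summit.NavierStokesRegularity.NavierStokesRegularity.Theses.FilamentSkeletonRss.RssProfileExists)) ∧
    (∀ S' S'' : Prop,
      ((S' → Summit.NavierStokesRegularity.NavierStokesRegularity.Theses.FilamentSkeletonRss.SkeletonEquilibrium) →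
        Summit.NavierStokesRegularity.NavierStokesRegularity.Theses.FilamentSkeletonRss.CoreGluing →
        (S' → Summit.NavierStokesRegularity.NavierStokesRegularity.Theses.FilamentSkeletonRss.RssProfileExists)) ∧
      ((Summit.NavierStokesRegularity.NavierStokesRegularity.Theses.FilamentSkeletonRss.SkeletonEquilibrium → S'') →
        (S'' → Summit.NavierStokesRegularity.NavierStokesRegularity.Theses.FilamentSkeletonRss.RssProfileExists) →
        Summit.NavierStokesRegularity.NavierStokesRegularity.Theses.FilamentSkeletonRss.CoreGluing)) :=
  ⟨coreGluing_of_not_skeletonEquilibrium, coreGluing_iff_not_skeletonEquilibrium_or_rssProfileExists,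
    fun _ _ => coreGluing_transfer⟩

end Summit.NavierStokesRegularity.NavierStokesRegularity.Theorems
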